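/-
Origin: expansion seat `prover-pub-hodgecm-mc-binder-1-g20-0`, handover #R133 2026-08-21T06:33:11Z md5 5e50d8e1b3c9 (144 l.; NEW additive KERNEL leaf, ns HodgeCM.Model(.LiuCMSide); imports #R132 (this kit) + own-htheta #H13 HodgeCM.Model.LiuCMSideOfReflex + #H14 HodgeCM.Model.LiuCMSideSubCorner (t73-ownhtheta kit); install AFTER all three; DROP-ALONE (nothing imports it); 0 defs, 0 records, nothing cited; `LiuCMSide.isSubCorner_of_isReflexOfType(G)_liftType` ∕ `isSubCorner_of_eq` (every admissible record of the (J4a) type is a #H14 sub-corner, L∕ℚ Galois only — twins of binder-2 `isCorner_of_isReflexOfType_liftType` ∕ `isCorner_of_scope(_of_eq)` without the sextic scope), `ofReflex_isSubCorner_liftType` ∕ `exists_isReflexOfTypeG_α_ne_zero_isSubCorner` (NON-VACUITY: #H13's `ofReflex` is an admissible sub-corner with α ≠ 0), `isSubCorner_of_liftTyped` ∕ `hJ_at_of_liftTyped_sub` (clause-2 socket twins of `Model/Binders/JLiuHJOfLiftType`, Galois only), `subset_Uiso_of_block_of_liftTyped` (#H14 `subset_Uiso_of_block_of_isSubCorner`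 with `hsub` discharged: ROW 9 FROM ONE BLOCK INTO `Uiso` AT ANY GALOIS L — the face-ready socket of pub-hodgecm2 own-b01's ask); NAME LIST: HodgeCM.Model.LiuCMSide.isSubCorner_of_isReflexOfType_liftType · HodgeCM.Model.LiuCMSide.isSubCorner_of_isReflexOfTypeG_liftType · HodgeCM.Model.LiuCMSide.isSubCorner_of_eq · HodgeCM.Model.LiuCMSide.ofReflex_isSubCorner_liftType · HodgeCM.Model.LiuCMSide.exists_isReflexOfTypeG_α_ne_zero_isSubCorner · HodgeCM.Model.isSubCorner_of_liftTyped · HodgeCM.Model.hJ_at_of_liftTyped_sub · HodgeCM.Model.subset_Uiso_of_block_of_liftTyped) (`HOME/mc/pub-hodgecm-mc-binder-1-g20/stage73/HodgeCM/Model/Binders/JLiuSubCornerAdm.lean`, md5 5e50d8e1b3c9, 144 lines);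
landed by the gen-31 packager (p-g31) in gate run 73 as `HodgeCM/Model/Binders/JLiuSubCornerAdm.lean` (verbatim).
-/
/-
Copyright (c) 2026 the pub-hodgecm formalisation cell (harness21).  New file, not vendored.
Origin: binder-1 lane (unit pub-hodgecm-mc-binder-1-g20, seat prover-pub-hodgecm-mc-binder-1-g20-0), 2026-08-21, as SUPPLIER of the
row-9 owner own-htheta.  Target in PKG: `HodgeCM/Model/Binders/JLiuSubCornerAdm.lean` (NEW additive KERNEL leaf; imports binder-1's
`Model/Binders/JLiuSubCornerOfReflex` (#R132) and own-htheta's `Model/LiuCMSideOfReflex` (#H13) ∕ `Model/LiuCMSideSubCorner` (#H14);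
nothing imports it; drop alone on bounce; ROWDEPS #R132, #H13, #H14).  KERNEL ONLY: theorems; no `Prop` minted, nothing cited anew, no new
hypothesis kind of E.  Nothing here is a claim of the manuscripts under adjudication.
-/
import Summits.HodgeConjecture.HodgeCM.Model.Binders.JLiuSubCornerOfReflex
import Summits.HodgeConjecture.HodgeCM.Model.LiuCMSideOfReflex
import Summits.HodgeConjecture.HodgeCM.Model.LiuCMSideSubCorner

set_option autoImplicit false

/-!
# (J5-subcorner), composed: every ADMISSIBLE record is a SUB-corner, at any Galois `L` — and one exists

binder-1's `LiuCMSide.exists_subCorner_of_isReflexOfType_liftType` (#R132: the sub-corner data of a reflex record, WITHOUT primitivity or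
degree hypotheses) + own-htheta's `LiuCMSide.reflexCMType` (#H13: the reflex type is a CM type) close own-htheta's `LiuCMSide.IsSubCorner`
(#H14) by `rfl` on the underlying set:

* `LiuCMSide.isSubCorner_of_isReflexOfType_liftType` ∕ `…TypeG…` ∕ `isSubCorner_of_eq` — for `L/ℚ` Galois and `C` admissible for the (J4a)
  type `liftType false K L j ι₁ Ψ`: `C.IsSubCorner K Ψ (ι₁ ∘ j)` (the sub-corner twins of binder-2's `isCorner_of_isReflexOfType_liftType` ∕
  `isCorner_of_scope` ∕ `isCorner_of_scope_of_eq`, with `[IsGalois ℚ L]` in place of E's sextic scope conjunction);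
* `LiuCMSide.ofReflex_isSubCorner_liftType`, `exists_isReflexOfTypeG_α_ne_zero_isSubCorner` — NON-VACUITY: own-htheta's reflex record
  `ofReflex` (#H13) is an admissible sub-corner with `α ≠ 0` at every corner;
* `isSubCorner_of_liftTyped`, `hJ_at_of_liftTyped_sub` — clause 2 of the junction in SUB-corner form from (J4a), Galois only (the twins of
  binder-2's `isCorner_of_liftTyped` ∕ `hJ_at_of_liftTyped`, `Model/Binders/JLiuHJOfLiftType`);
* `subset_Uiso_of_block_of_liftTyped` — ROW 9 FROM ONE BLOCK INTO E's `Uiso` AT ANY GALOIS `L` (own-htheta #H14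
  `subset_Uiso_of_block_of_isSubCorner` with its `hsub` DISCHARGED from (J4a) + Galois-guarded admissibility): the face-ready socket asked
  by pub-hodgecm2 own-b01 (pub-hodgecm INBOX l.138 (1)).

KIND: kernel, 0 proof holes, nothing cited anew; expected `#print axioms` ⊆ {propext, Classical.choice, Quot.sound}.
-/

noncomputable section

open scoped TensorProduct Pointwise
open NumberField CategoryTheory Module
open Literature.AlgebraicGeometry.Motives (CMType)
open Literature.AlgebraicGeometry.HodgeTheory
open Literature.NumberTheory.Automorphic.PicardCM
open Literature.NumberTheory.ComplexMultiplication
open HodgeCM.Literature.Theta HodgeCM.Literature.Theta.LiuAlbaneseModuleDatum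

namespace HodgeCM

namespace Model

namespace LiuCMSide

variable {L : CMField} {ι₁ : L →+* ℂ} {K : CMField}

/-- **Every admissible reflex record of the (J4a) type is a SUB-corner** (`L/ℚ` Galois; no primitivity, no degree): binder-1 #R132 + own-htheta
#H13 `reflexCMType` (`rfl` on the underlying set) ⇒ own-htheta #H14 `IsSubCorner`. [folklore] -/
theorem isSubCorner_of_isReflexOfType_liftType [IsGalois ℚ L] (C : LiuCMSide) (Ψ : CMType K) (j : K →+* L)
    (h : C.IsReflexOfType ι₁ (SignRecipe.liftType false K L j ι₁ Ψ)) : C.IsSubCorner K Ψ (ι₁.comp j) :=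
  exists_subCorner_of_isReflexOfType_liftType C Ψ j (reflexCMType ι₁ (SignRecipe.liftType false K L j ι₁ Ψ)) rfl h

/-- The same for the Galois-guarded admissibility predicate `IsReflexOfTypeG` (the dictionary's `adm μ d`). [folklore] -/
theorem isSubCorner_of_isReflexOfTypeG_liftType [hG : IsGalois ℚ L] (C : LiuCMSide) (Ψ : CMType K) (j : K →+* L)
    (h : C.IsReflexOfTypeG ι₁ (SignRecipe.liftType false K L j ι₁ Ψ)) : C.IsSubCorner K Ψ (ι₁.comp j) :=
  isSubCorner_of_isReflexOfType_liftType C Ψ j (h hG)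

/-- Substituted form (the sub-corner twin of `isCorner_of_scope_of_eq`): with the guard's `ι₁ ∘ j = σ` and the (J4a) identification
`Φ = liftType false K L j ι₁ Ψ` as hypotheses, `C.IsSubCorner K Ψ σ` on the nose — `L/ℚ` Galois only. [folklore] -/
theorem isSubCorner_of_eq [IsGalois ℚ L] {j : K →+* L} {σ : K →+* ℂ} (hj : ι₁.comp j = σ) (Ψ : CMType K) {Φ : CMType L}
    (hΦ : Φ = SignRecipe.liftType false K L j ι₁ Ψ) (C : LiuCMSide) (h : C.IsReflexOfTypeG ι₁ Φ) : C.IsSubCorner K Ψ σ := by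
  subst hj hΦ
  exact isSubCorner_of_isReflexOfTypeG_liftType C Ψ j h

/-- **NON-VACUITY**: own-htheta's admissible reflex record `ofReflex ι₁ hCM Φ_μ` (#H13) IS a sub-corner of every corner `(K, Ψ, ι₁ ∘ j)` whose
(J4a) type is `Φ_μ` — so the `hsub`-guarded comprehension of r8's generator set is inhabited by a record that actually contributes
surface classes. [folklore] -/
theorem ofReflex_isSubCorner_liftType [IsGalois ℚ L] (hCM : CMAbelianVarietyRealised) (Ψ : CMType K) (j : K →+* L) :
    (ofReflex ι₁ hCM (SignRecipe.liftType false K L j ι₁ Ψ)).IsSubCorner K Ψ (ι₁.comp j) :=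
  isSubCorner_of_isReflexOfType_liftType _ Ψ j (ofReflex_isReflexOfType ι₁ hCM _)

/-- … packaged: an admissible record with `α ≠ 0` which is a sub-corner exists at every corner (`L/ℚ` Galois). [folklore] -/
theorem exists_isReflexOfTypeG_α_ne_zero_isSubCorner [IsGalois ℚ L] (hCM : CMAbelianVarietyRealised) (Ψ : CMType K)
    (j : K →+* L) : ∃ d : LiuCMSide, d.IsReflexOfTypeG ι₁ (SignRecipe.liftType false K L j ι₁ Ψ) ∧ d.α ≠ 0 ∧
      d.IsSubCorner K Ψ (ι₁.comp j) :=
  ⟨ofReflex ι₁ hCM _, ofReflex_isReflexOfTypeG ι₁ hCM _, ofReflex_α_ne_zero ι₁ hCM _, ofReflex_isSubCorner_liftType hCM Ψ j⟩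

end LiuCMSide

/-! ## Clause 2 in sub-corner form from (J4a), and the one-block socket into `Uiso`, at any Galois `L` -/

section Socket

variable {L : CMField} {ι₁ : L →+* ℂ}

/-- **Clause 2 (`hsub`) from (J4a), GALOIS ONLY**: a CM record admissible in the Galois-guarded sense for a type `Φ` carrying the (J4a)
identification at the corner `(c.K, c.Ψ i, c.σ)` is a SUB-corner of it (the twin of binder-2's `isCorner_of_liftTyped`, E's sextic scope
conjunction replaced by `[IsGalois ℚ L]`). [folklore] -/
theorem isSubCorner_of_liftTyped [IsGalois ℚ L] {c : SeesawCtx L} {i : Fin 4} {Φ : CMType L}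
    (hΦ : ∃ j : c.K →+* L, ι₁.comp j = c.σ ∧ Φ = SignRecipe.liftType false c.K L j ι₁ (c.Ψ i))
    (d : LiuCMSide) (hd : d.IsReflexOfTypeG ι₁ Φ) : d.IsSubCorner c.K (c.Ψ i) c.σ := by
  obtain ⟨j, hj, hΦ⟩ := hΦ
  exact LiuCMSide.isSubCorner_of_eq hj (c.Ψ i) hΦ d hd

/-- **The pointwise socket, sub-corner form** (twin of `hJ_at_of_liftTyped`, Galois only): from bare dictionary data `(PhiMu, adm)` read off a
type map and a finite set of characters satisfying (J4a) plus any further clause `Q`, the clauses `PhiMu`, `hsub` and `Q`. [folklore] -/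
theorem hJ_at_of_liftTyped_sub [IsGalois ℚ L] {Char : Type*} (PhiMu : Char → Prop) (adm : Char → LiuCMSide → Prop)
    (typeOf : Char → CMType L)
    (hPhi : ∀ μ, ι₁ ∈ (typeOf μ).1 → PhiMu μ) (hadm : ∀ μ d, adm μ d → d.IsReflexOfTypeG ι₁ (typeOf μ))
    {c : SeesawCtx L} {i : Fin 4} (hmem : c.σ ∈ (c.Ψ i).1) (Q : Finset Char → Prop)
    (hJ4 : ∃ S : Finset Char,
      (∀ μ ∈ S, ∃ j : c.K →+* L, ι₁.comp j = c.σ ∧ typeOf μ = SignRecipe.liftType false c.K L j ι₁ (c.Ψ i)) ∧ Q S) :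
    ∃ S : Finset Char,
      (∀ μ ∈ S, PhiMu μ) ∧ (∀ μ ∈ S, ∀ d : LiuCMSide, adm μ d → d.IsSubCorner c.K (c.Ψ i) c.σ) ∧ Q S := by
  obtain ⟨S, hS, hQ⟩ := hJ4
  exact ⟨S, fun μ hμ => hPhi μ (self_mem_of_liftTyped hmem (hS μ hμ)),
    fun μ hμ d hd => isSubCorner_of_liftTyped (hS μ hμ) d (hadm μ d hd), hQ⟩

end Socket

section Dictionary

variable {hHD : exists_isReal_hodgeModel} {hI : hodgePQ_independent_of_hodgeModel}
  {h₁ : BallQuotientUniformised} {h₃ : CMAbelianVarietyRealised}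
variable {L : CMField} {ι₁ : L →+* ℂ} {V : HermSpace3 L ι₁} (T : LiuDictionary hHD hI h₁ h₃ V)

/-- **ROW 9 FROM ONE BLOCK INTO `Uiso`, AT ANY GALOIS `L`** (own-htheta #H14 `subset_Uiso_of_block_of_isSubCorner` with `hsub` DISCHARGED):
if `Thm418C` holds for the dictionary `T`, `μ` is a character with `PhiMu μ` whose admissible records are Galois-guarded reflex records of a
type `Φ` carrying the (J4a) identification at the corner `(c.K, c.Ψ i, c.σ)` (`c.σ ∈ Ψ_i`), and every class of `Θ Γ` is the restriction of
a `Γ.K`-fixed vector of `block μ`, then below r8's threshold the classes lie in `Uiso Γ c.K (c.Ψ i) c.σ` — no primitivity, no degree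
hypothesis on `c.K` or `L` (the face-ready form asked by pub-hodgecm2 own-b01). [folklore] -/
theorem subset_Uiso_of_block_of_liftTyped [IsGalois ℚ L] (hR : DeligneMilne1982_Thm_6_20_full) (h418 : T.Thm418C)
    {c : SeesawCtx L} {i : Fin 4} (hmem : c.σ ∈ (c.Ψ i).1) (μ : T.Char) (hΦμ : T.PhiMu μ) {Φ : CMType L}
    (hΦ : ∃ j : c.K →+* L, ι₁.comp j = c.σ ∧ Φ = SignRecipe.liftType false c.K L j ι₁ (c.Ψ i))
    (hadm : ∀ d : LiuCMSide, T.adm μ d → d.IsReflexOfTypeG ι₁ Φ)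
    (Θ : ∀ Γ : Level V, Set ((picardCMUniverse hHD hI h₁ h₃).CohC ((picardCMUniverse hHD hI h₁ h₃).pms L ι₁ V Γ) 1))
    (hIso : ∀ (Γ : Level V), ∀ ω ∈ Θ Γ, ∃ x : T.H, x ∈ fixedBy Γ.K T.H ∧ T.res Γ x = ω ∧ x ∈ T.block μ) :
    ∃ Γ₀ : Level V, ∀ Γ ≤ Γ₀, Θ Γ ⊆ (picardCMUniverse hHD hI h₁ h₃).Uiso Γ c.K (c.Ψ i) c.σ :=
  subset_Uiso_of_block_of_isSubCorner T hR h418 hmem μ hΦμ (fun d hd => isSubCorner_of_liftTyped hΦ d (hadm d hd)) Θ hIso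

end Dictionary

end Model

end HodgeCM

end
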